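import Literature.MathematicalPhysics.QuantumLattice.TorusPlaquetteProductStates
import Literature.MathematicalPhysics.QuantumLattice.HubbardSzSectorLadder
import Literature.MathematicalPhysics.QuantumLattice.LiebMattisLadder
import HarnessLib

/-!
# The plaquette-boson dictionary map `Φ` of the checkerboard torus: isometry, sectors, energies

The plaquette-boson dictionary (Tsai–Kivelson 2006, App. A; Yao–Tsai–Kivelson 2007, eq. (2);
Altman–Auerbach 2002, §II.D) identifies the `S = ½` space of the `M × M` plaquette torus — an up
spin at the plaquette `R` meaning ONE HOLE PAIR on `R` (plaquette state `|2h⟩`), a down spin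
meaning the undoped plaquette (`|0h⟩`) — with the span of the products of plaquette ground states
inside the Fock space of the `2M × 2M` electron torus. With the Koszul product states of
`ClusterProductStates` over the plaquette partition (`TorusPlaquettePartition`) this file DEFINES
that map and PROVES the linear-algebra clauses of the dictionary (for `M ≥ 2`; the hypotheses
`L = 2M`, `8 ≤ L` of the crux statements are this with `L := 2M`):

* `dictionaryMap M U : Matrix (Finset (Orb (FermionTorus 2 (2M)))) (TensorIndex (TorusSite 2 M) 2) ℂ`,
  column `σ ↦ ⊗_R plaquetteStates U (rev (σ R))` (`σ_R = 0` = up = `|2h⟩`, `σ_R = 1` = down = `|0h⟩`);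
* **(a) isometry** `dictionaryMap_conjTranspose_mul_self : Φᴴ Φ = 1` (the two plaquette states are
  orthonormal: unit vectors with different electron numbers; inner products of product states
  factor);
* **(b) sectors** `dictionaryMap_mulVec_mem_szSector`: for `φ` in the spin sector
  `S^z_tot = N_b − M²/2` (`N_b` up spins = bosons), `Φ φ` lies in the electron sector
  `(N, S^z) = ((2M)² − 2N_b, 0)` (electron numbers and spin imbalances add over the plaquettes,
  `isInSector_prodFamily`);
* **(b) energies** `hamiltonian_intra_mulVec_dictionaryMap_mulVec`: on that sector
  `H_intra (Φ φ) = ((M² − N_b) E(0h) + N_b E(2h)) Φ φ` with `E(0h) = plaquetteEnergy U 0`,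
  `E(2h) = plaquetteEnergy U 2` and `H_intra = hamiltonian (fermionTorusGraph 2 (2M) \ comap (·/2) ⊤) 1 U`
  the summit's intra-plaquette Hamiltonian.

References: W.-F. Tsai, S. A. Kivelson, PRB 73 (2006) 214510, App. A [TsaiKivelson2006]; H. Yao,
W.-F. Tsai, S. A. Kivelson, PRB 76 (2007) 161104(R), eq. (2) [YaoTsaiKivelson2007]; E. Altman,
A. Auerbach, PRB 65 (2002) 104508, §II.D [AltmanAuerbach2002]. Tree: `plaquetteStates_spec`,
`plaquetteHamiltonian_mulVec_plaquetteStates` (`PlaquettePairCouplings`); `mem_szSector_iff_isInSector`,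
`IsInSector`, `upPart`, `downPart` (`HubbardSzSectorLadder`, `HubbardLiebConfig`);
`mem_spinZSector_weight_iff` (`LiebMattisLadder`); `hamiltonian_intra_mulVec_prodFamily`
(`TorusPlaquetteProductStates`).
-/

noncomputable section

namespace Literature.MathematicalPhysics.QuantumLattice

open Matrix Finset TwoCluster Literature.Probability.LatticeModels

/-! ### Fock vectors of different particle numbers are orthogonal -/

section Orthogonal

variable {ι : Type*} [Fintype ι]

/-- Vectors with different particle numbers are orthogonal (disjoint supports). [folklore] -/
theorem dotProduct_eq_zero_of_isNParticle_ne {N N' : ℕ} (h : N ≠ N') {x y : Fock ι}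
    (hx : IsNParticle N x) (hy : IsNParticle N' y) : star x ⬝ᵥ y = 0 := by
  refine Finset.sum_eq_zero fun s _ => ?_
  rw [Pi.star_apply]
  by_cases hs : s.card = N
  · rw [hy s (by rw [hs]; exact h), mul_zero]
  · rw [hx s hs, star_zero, zero_mul]

end Orthogonal

/-! ### The two plaquette states -/

/-- The plaquette state with `k` hole pairs has `4 − 2k` electrons. [folklore] -/
theorem isNParticle_plaquetteStates (U : ℝ) (k : Fin 2) : IsNParticle (4 - 2 * (k : ℕ)) (plaquetteStates U k) :=
  ((mem_szSector_iff _ _ _).1 (plaquetteStates_spec U k).2.1).1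

/-- The plaquette state with `k` hole pairs lies in the spin sector `(N↑, N↓) = (2 − k, 2 − k)`.
[folklore] -/
theorem isInSector_plaquetteStates (U : ℝ) (k : Fin 2) :
    IsInSector (2 - (k : ℕ)) (2 - (k : ℕ)) (plaquetteStates U k) := by
  have hmem := (plaquetteStates_spec U k).2.1
  fin_cases k
  · have h := mem_szSector_iff_isInSector 2 2 (plaquetteStates U 0)
    norm_num at h hmem ⊢
    exact h.1 hmem
  · have h := mem_szSector_iff_isInSector 1 1 (plaquetteStates U 1)
    norm_num at h hmem ⊢
    exact h.1 hmem

/-- **The two plaquette states are orthonormal.** [folklore] -/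
theorem star_plaquetteStates_dotProduct (U : ℝ) (k' k : Fin 2) :
    star (plaquetteStates U k') ⬝ᵥ plaquetteStates U k = if k' = k then 1 else 0 := by
  by_cases h : k' = k
  · rw [if_pos h, h]
    exact (plaquetteStates_spec U k).1
  · rw [if_neg h]
    refine dotProduct_eq_zero_of_isNParticle_ne ?_ (isNParticle_plaquetteStates U k')
      (isNParticle_plaquetteStates U k)
    fin_cases k' <;> fin_cases k <;> simp_all

namespace TorusPlaquette

variable {M : ℕ}

/-! ### Counting up and down electrons plaquette by plaquette -/

/-- **Sites of the torus ↔ (plaquette, position).** [folklore] -/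
def siteEquiv (M : ℕ) : FermionTorus 2 M × PlaquetteSite ≃ FermionTorus 2 (2 * M) where
  toFun p := plaqSite M p.1 p.2
  invFun x := (blockOf M x, posOf M x)
  left_inv p := by simp [blockOf_plaqSite, posOf_plaqSite]
  right_inv x := plaqSite_blockOf_posOf M x

/-- A count of sites decomposes over the plaquettes. [folklore] -/
theorem card_filter_sites (Q : FermionTorus 2 (2 * M) → Prop) [DecidablePred Q] :
    (Finset.univ.filter Q).card = ∑ R : FermionTorus 2 M, (Finset.univ.filter fun a => Q (plaqSite M R a)).card := by
  simp only [Finset.card_filter]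
  rw [← (siteEquiv M).sum_comp, Fintype.sum_prod_type]
  rfl

/-- The up electrons of a configuration, counted plaquette by plaquette. [folklore] -/
theorem card_upPart_eq_sum (s : Finset (Orb (FermionTorus 2 (2 * M)))) :
    (upPart s).card = ∑ R : FermionTorus 2 M, (upPart ((plaquettePartition M).part R s)).card := by
  rw [upPart, card_filter_sites]
  refine Finset.sum_congr rfl fun R _ => ?_
  rw [upPart]
  congr 1
  ext a
  simp only [Finset.mem_filter, Finset.mem_univ, true_and, ClusterProduct.Partition.mem_part,
    plaquettePartition_emb, plaqOrbEmb_orb]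

/-- The down electrons of a configuration, counted plaquette by plaquette. [folklore] -/
theorem card_downPart_eq_sum (s : Finset (Orb (FermionTorus 2 (2 * M)))) :
    (downPart s).card = ∑ R : FermionTorus 2 M, (downPart ((plaquettePartition M).part R s)).card := by
  rw [downPart, card_filter_sites]
  refine Finset.sum_congr rfl fun R _ => ?_
  rw [downPart]
  congr 1
  ext a
  simp only [Finset.mem_filter, Finset.mem_univ, true_and, ClusterProduct.Partition.mem_part,
    plaquettePartition_emb, plaqOrbEmb_orb]

/-- **Spin sectors multiply**: a product of plaquette vectors in the sectors `(a_R, b_R)` lies in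
the sector `(Σ a_R, Σ b_R)` of the torus. [folklore] -/
theorem isInSector_prodFamily {a b : FermionTorus 2 M → ℕ} {ψ : FermionTorus 2 M → Fock (Orb PlaquetteSite)}
    (hψ : ∀ R, IsInSector (a R) (b R) (ψ R)) :
    IsInSector (∑ R, a R) (∑ R, b R) ((plaquettePartition M).prodFamily ψ) := by
  intro s hs
  by_contra hne
  rw [ClusterProduct.Partition.prodFamily_apply] at hne
  have hfac : ∀ R, ψ R ((plaquettePartition M).part R s) ≠ 0 := fun R h0 =>
    hne (mul_eq_zero_of_right _ (Finset.prod_eq_zero (Finset.mem_univ R) h0))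
  have hloc : ∀ R, (upPart ((plaquettePartition M).part R s)).card = a R ∧
      (downPart ((plaquettePartition M).part R s)).card = b R := fun R => by
    by_contra h
    exact hfac R (hψ R _ h)
  apply hs
  rw [card_upPart_eq_sum, card_downPart_eq_sum]
  exact ⟨Finset.sum_congr rfl fun R _ => (hloc R).1, Finset.sum_congr rfl fun R _ => (hloc R).2⟩

/-! ### The dictionary map -/

/-- The plaquette states selected by a spin configuration of the plaquette torus: up (`σ = 0`) at
`R` = one hole pair on `R` (`|2h⟩ = plaquetteStates U 1`), down (`σ = 1`) = undoped
(`|0h⟩ = plaquetteStates U 0`). [cite: YaoTsaiKivelson2007, eq. (2)] -/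
def plaqFamily (U : ℝ) (σ : TensorIndex (TorusSite 2 M) 2) : FermionTorus 2 M → Fock (Orb PlaquetteSite) :=
  fun R => plaquetteStates U (σ (FermionTorus.toTorusSite R)).rev

/-- **The dictionary map `Φ`**: the matrix whose column at the spin configuration `σ` is the
Koszul product state `⊗_R plaquetteStates U (rev (σ_R))` of the selected plaquette states.
[cite: TsaiKivelson2006, App. A] -/
def dictionaryMap (M : ℕ) (U : ℝ) :
    Matrix (Finset (Orb (FermionTorus 2 (2 * M)))) (TensorIndex (TorusSite 2 M) 2) ℂ :=
  fun s σ => (plaquettePartition M).prodFamily (plaqFamily U σ) s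

/-- The columns of `Φ` are the product states. [folklore] -/
theorem dictionaryMap_col (U : ℝ) (σ : TensorIndex (TorusSite 2 M) 2) :
    (fun s => dictionaryMap M U s σ) = (plaquettePartition M).prodFamily (plaqFamily U σ) := rfl

/-- `Φ v = Σ_σ v σ · (column σ)`. [folklore] -/
theorem dictionaryMap_mulVec [NeZero M] (U : ℝ) (v : TensorIndex (TorusSite 2 M) 2 → ℂ) :
    dictionaryMap M U *ᵥ v = ∑ σ, v σ • (plaquettePartition M).prodFamily (plaqFamily U σ) := by
  funext s
  rw [mulVec, dotProduct, Finset.sum_apply]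
  exact Finset.sum_congr rfl fun σ _ => mul_comm _ _

/-- **Columns of `Φ` are orthonormal**: `⟨⊗ ψ(σ'), ⊗ ψ(σ)⟩ = [σ' = σ]`. [folklore] -/
theorem star_col_dotProduct_col [NeZero M] (U : ℝ) (σ' σ : TensorIndex (TorusSite 2 M) 2) :
    star ((plaquettePartition M).prodFamily (plaqFamily U σ')) ⬝ᵥ
        (plaquettePartition M).prodFamily (plaqFamily U σ) = if σ' = σ then 1 else 0 := by
  rw [ClusterProduct.Partition.star_prodFamily_dotProduct_prodFamily]
  simp only [plaqFamily, star_plaquetteStates_dotProduct]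
  by_cases h : σ' = σ
  · rw [if_pos h, h]
    exact Finset.prod_eq_one fun R _ => if_pos rfl
  · rw [if_neg h]
    have hne : ∃ R : FermionTorus 2 M, σ' (FermionTorus.toTorusSite R) ≠ σ (FermionTorus.toTorusSite R) := by
      by_contra hall
      apply h
      funext y
      by_contra hy
      exact hall ⟨FermionTorus.ofTorusSite y, by simpa using hy⟩
    obtain ⟨R, hR⟩ := hne
    exact Finset.prod_eq_zero (Finset.mem_univ R) (if_neg fun h' => hR (Fin.rev_injective h'))

/-- **(a) `Φ` is an isometry**: `Φᴴ Φ = 1`. [cite: TsaiKivelson2006, App. A] -/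
theorem dictionaryMap_conjTranspose_mul_self [NeZero M] (U : ℝ) :
    (dictionaryMap M U)ᴴ * dictionaryMap M U = 1 := by
  ext σ' σ
  rw [Matrix.mul_apply, Matrix.one_apply]
  have h := star_col_dotProduct_col U σ' σ
  rw [dotProduct] at h
  simpa [conjTranspose_apply, dictionaryMap] using h

/-! ### Spin sectors ↦ electron sectors and energies -/

/-- The plaquettes ↔ the spin sites `(ℤ/Mℤ)²`. [folklore] -/
def torusSiteEquiv (M : ℕ) [NeZero M] : FermionTorus 2 M ≃ TorusSite 2 M where
  toFun := FermionTorus.toTorusSite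
  invFun := FermionTorus.ofTorusSite
  left_inv := FermionTorus.ofTorusSite_toTorusSite
  right_inv := FermionTorus.toTorusSite_ofTorusSite

/-- Reindexing a sum over spin sites by plaquettes. [folklore] -/
theorem sum_toTorusSite [NeZero M] {α : Type*} [AddCommMonoid α] (f : TorusSite 2 M → α) :
    ∑ R : FermionTorus 2 M, f (FermionTorus.toTorusSite R) = ∑ y, f y :=
  (torusSiteEquiv M).sum_comp f

/-- There are `M²` plaquettes. [folklore] -/
theorem card_fermionTorus_two (M : ℕ) : Fintype.card (FermionTorus 2 M) = M ^ 2 := by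
  rw [Fintype.card_lex, Fintype.card_fun, Fintype.card_fin, Fintype.card_fin]

/-- There are `M²` spin sites. [folklore] -/
theorem card_torusSite_two (M : ℕ) [NeZero M] : Fintype.card (TorusSite 2 M) = M ^ 2 := by
  rw [Fintype.card_fun, ZMod.card, Fintype.card_fin]

/-- The number of down spins (`σ = 1`) of a configuration — its weight. [folklore] -/
def downWeight [NeZero M] (σ : TensorIndex (TorusSite 2 M) 2) : ℕ := ∑ y, (σ y : ℕ)

/-- A plaquette state indexed by a spin: `rev σ` hole pairs means `1 + σ` up and `1 + σ` down
electrons. [folklore] -/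
theorem two_sub_rev (k : Fin 2) : 2 - ((Fin.rev k : Fin 2) : ℕ) = 1 + (k : ℕ) := by
  fin_cases k <;> rfl

/-- **The column at `σ` lies in the electron sector `(N, S^z) = (2(M² + W(σ)), 0)`**, `W` the
number of down spins (each up spin removes one electron pair). [cite: TsaiKivelson2006, App. A] -/
theorem col_mem_szSector [NeZero M] (U : ℝ) (σ : TensorIndex (TorusSite 2 M) 2) :
    (plaquettePartition M).prodFamily (plaqFamily U σ) ∈
      szSector (Λ := FermionTorus 2 (2 * M)) (2 * (M ^ 2 + downWeight σ)) 0 := by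
  have hA := isInSector_prodFamily (M := M)
    (fun R => isInSector_plaquetteStates U (σ (FermionTorus.toTorusSite R)).rev)
  have hsum : ∑ R : FermionTorus 2 M, (2 - ((Fin.rev (σ (FermionTorus.toTorusSite R)) : Fin 2) : ℕ)) =
      M ^ 2 + downWeight σ := by
    simp only [two_sub_rev]
    rw [Finset.sum_add_distrib, Finset.sum_const, Finset.card_univ, card_fermionTorus_two, smul_eq_mul,
      mul_one, downWeight, sum_toTorusSite (fun y => (σ y : ℕ))]
  rw [hsum] at hA
  rw [szSector_two_mul_zero_eq]
  exact (mem_szSector_iff_isInSector _ _ _).2 hA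

/-- The spin sector `S^z_tot = N_b − M²/2` is the weight sector `W = M² − N_b`. [folklore] -/
theorem apply_eq_zero_of_mem_spinZSector [NeZero M] {Nb : ℕ} (hNb : Nb ≤ M ^ 2)
    {φ : TensorIndex (TorusSite 2 M) 2 → ℂ}
    (hφ : φ ∈ spinZSector (Λ := TorusSite 2 M) 1 ((Nb : ℝ) - (M : ℝ) ^ 2 / 2))
    (σ : TensorIndex (TorusSite 2 M) 2) (hσ : downWeight σ ≠ M ^ 2 - Nb) : φ σ = 0 := by
  have hcast : (((Fintype.card (TorusSite 2 M) * 1 : ℕ) : ℝ) / 2 - ((M ^ 2 - Nb : ℕ) : ℝ)) =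
      (Nb : ℝ) - (M : ℝ) ^ 2 / 2 := by
    rw [card_torusSite_two, Nat.cast_sub hNb]
    push_cast
    ring
  rw [← hcast] at hφ
  exact (LiebMattis.mem_spinZSector_weight_iff 1 (M ^ 2 - Nb) φ).1 hφ σ hσ

/-- **(b) Sectors**: `Φ` maps the spin sector `S^z_tot = N_b − M²/2` (`N_b ≤ M²` up spins =
bosons) into the electron sector `(N, S^z) = ((2M)² − 2N_b, 0)`. [cite: TsaiKivelson2006, App. A] -/
theorem dictionaryMap_mulVec_mem_szSector [NeZero M] (U : ℝ) {Nb : ℕ} (hNb : Nb ≤ M ^ 2)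
    {φ : TensorIndex (TorusSite 2 M) 2 → ℂ}
    (hφ : φ ∈ spinZSector (Λ := TorusSite 2 M) 1 ((Nb : ℝ) - (M : ℝ) ^ 2 / 2)) :
    dictionaryMap M U *ᵥ φ ∈ szSector (Λ := FermionTorus 2 (2 * M)) ((2 * M) ^ 2 - 2 * Nb) 0 := by
  rw [dictionaryMap_mulVec]
  refine Submodule.sum_mem _ fun σ _ => ?_
  by_cases hw : downWeight σ = M ^ 2 - Nb
  · have h := col_mem_szSector U σ
    have heq : 2 * (M ^ 2 + downWeight σ) = (2 * M) ^ 2 - 2 * Nb := by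
      rw [hw]
      have : Nb ≤ M ^ 2 := hNb
      zify [this, show 2 * Nb ≤ (2 * M) ^ 2 by nlinarith]
      ring
    rw [heq] at h
    exact Submodule.smul_mem _ _ h
  · rw [apply_eq_zero_of_mem_spinZSector hNb hφ σ hw, zero_smul]
    exact Submodule.zero_mem _

/-- The plaquette energy selected by a spin, as an affine function of the spin:
`E(2·rev σ) = (1 − σ) E(2h) + σ E(0h)`. [folklore] -/
theorem plaquetteEnergy_two_mul_rev (U : ℝ) (k : Fin 2) :
    ((plaquetteEnergy U (2 * ((Fin.rev k : Fin 2) : ℕ)) : ℝ) : ℂ) =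
      (1 - ((k : ℕ) : ℂ)) * (plaquetteEnergy U 2 : ℂ) + ((k : ℕ) : ℂ) * (plaquetteEnergy U 0 : ℂ) := by
  fin_cases k <;> simp

/-- **The column at `σ` is an eigenvector of the intra-plaquette Hamiltonian** with eigenvalue
`(M² − W) E(2h) + W E(0h)`, `W` the number of down spins. [cite: TsaiKivelson2006, App. A] -/
theorem hamiltonian_intra_mulVec_col [NeZero M] (hM : 2 ≤ M) (U : ℝ) (σ : TensorIndex (TorusSite 2 M) 2) :
    hamiltonian (fermionTorusGraph 2 (2 * M) \
        SimpleGraph.comap (fun x : FermionTorus 2 (2 * M) => fun i : Fin 2 => ((ofLex x) i : ℕ) / 2) ⊤) 1 U *ᵥ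
        (plaquettePartition M).prodFamily (plaqFamily U σ) =
      ((((M : ℂ) ^ 2 - (downWeight σ : ℂ)) * (plaquetteEnergy U 2 : ℂ) +
          (downWeight σ : ℂ) * (plaquetteEnergy U 0 : ℂ))) • (plaquettePartition M).prodFamily (plaqFamily U σ) := by
  rw [hamiltonian_intra_mulVec_prodFamily hM U (ψ := plaqFamily U σ)
    (E := fun R => ((plaquetteEnergy U (2 * ((Fin.rev (σ (FermionTorus.toTorusSite R)) : Fin 2) : ℕ)) : ℝ) : ℂ))
    (fun R => plaquetteHamiltonian_mulVec_plaquetteStates U (σ (FermionTorus.toTorusSite R)).rev)]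
  congr 1
  simp only [plaquetteEnergy_two_mul_rev]
  rw [Finset.sum_add_distrib, ← Finset.sum_mul, ← Finset.sum_mul, Finset.sum_sub_distrib, Finset.sum_const,
    Finset.card_univ, card_fermionTorus_two, sum_toTorusSite (fun y => ((σ y : ℕ) : ℂ)), downWeight]
  push_cast
  ring

/-- **(b) Energies**: on the spin sector `S^z_tot = N_b − M²/2`,
`H_intra (Φ φ) = ((M² − N_b) E(0h) + N_b E(2h)) Φ φ` — the image of `Φ` lies in the
`E₀(N_b)`-eigenspace of the decoupled plaquettes. [cite: TsaiKivelson2006, App. A] -/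
theorem hamiltonian_intra_mulVec_dictionaryMap_mulVec [NeZero M] (hM : 2 ≤ M) (U : ℝ) {Nb : ℕ}
    (hNb : Nb ≤ M ^ 2) {φ : TensorIndex (TorusSite 2 M) 2 → ℂ}
    (hφ : φ ∈ spinZSector (Λ := TorusSite 2 M) 1 ((Nb : ℝ) - (M : ℝ) ^ 2 / 2)) :
    hamiltonian (fermionTorusGraph 2 (2 * M) \
        SimpleGraph.comap (fun x : FermionTorus 2 (2 * M) => fun i : Fin 2 => ((ofLex x) i : ℕ) / 2) ⊤) 1 U *ᵥ
        (dictionaryMap M U *ᵥ φ) =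
      ((((M : ℝ) ^ 2 - Nb) * plaquetteEnergy U 0 + Nb * plaquetteEnergy U 2 : ℝ) : ℂ) • (dictionaryMap M U *ᵥ φ) := by
  rw [dictionaryMap_mulVec, mulVec_sum, Finset.smul_sum]
  refine Finset.sum_congr rfl fun σ _ => ?_
  by_cases hw : downWeight σ = M ^ 2 - Nb
  · rw [mulVec_smul, hamiltonian_intra_mulVec_col hM U σ, smul_comm]
    congr 1
    rw [hw, Nat.cast_sub hNb]
    push_cast
    ring
  · rw [apply_eq_zero_of_mem_spinZSector hNb hφ σ hw, zero_smul, mulVec_zero, smul_zero]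

end TorusPlaquette

end Literature.MathematicalPhysics.QuantumLattice

end
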